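import Mathlib

/-!
# T⁴ programme, node NE3 (η-rate of the minimisers), route P3 — leaf L8 «PROJ» (typer sub-row S6-Y8), file (a′):
# THE ABSTRACT CONSTRAINT PROJECTOR `P = 1 − Ks·H⁻¹·K` AND ITS WEIGHT-CONJUGATION DEFECT

NE3 formalisation swarm `b2b-balaban-t4-ne3-formalise-*` of the cell `pub-balaban`, unit `b2b-balaban-t4-ne3-formalise-leaf-04`
(LEAF PROVER 04, gen 2), sub-row **S6-Y8** of `t4/formal/NE3/LEAVES.md` (journal `CLAIM NE3-S6-Y8`, 2026-08-20T09:53Z; road P3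
skeleton `t4/skeletons/NE3-t4-ne3-p3.md` §1 LOCAL ∕ §2 L8; SHAPE `t4/formal/NE3/Statements/S6-Y8-SHAPE-v1.md`).

WHY.  Road P3's local step instantiates the tree's `T4ConstrainedAgmonD.agmon_constrained_tangent_projector`, whose leaf-L8
inputs are EXACTLY: a linear `P` with `hPT : ∀ v ∈ T, P v = v`, `hPr : ∀ h, P h ∈ T` (a projector ONTO the tangent space
`T` of the constraints) and the two WEIGHT-CONJUGATION DEFECTS `hda : N ((w ∘ P ∘ w⁻¹ − P) h) ≤ θa·N h`,
`hdb : N ((P − w⁻¹ ∘ P ∘ w) h) ≤ θb·N h` with `θa, θb = O(μ)` (`w = e^{μρ}` the Agmon weight).  The skeleton's formula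
`P_U = 1 − Q*(QQ*)⁻¹Q − (gauge block)` is the case `K = (Q_U, R(U)D*_U)` stacked, `Ks` = its energy-adjoint, `H = K Ks` the
Gram operator (gapped: L8 (a)(b)), and the defects come from the FINITE RANGE of `K` (conjugation by the weight moves a
finite-range operator by `O(μ)`) together with the Combes–Thomas bound for the conjugated inverse (L8 (c) =
`NE3ProjectorLocality.weighted_inverse_bound`, in the tree).  THIS FILE is the abstract algebra in between ([folklore] linear
algebra over real normed spaces, in the hypothesis style of `NE3ProjectorLocality`: every operator fact is a pointwise bound
supplied by the instantiation rows (a)(b), nothing about Bałaban's operators is asserted):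

§1 THE PROJECTOR: for linear `K : E → F`, `Ks : F → E`, `Hinv : F → F` with `K (Ks (Hinv y)) = y` (right inverse of the Gram
   operator `H = K ∘ Ks`) and ANY `P` with `P v = v − Ks (Hinv (K v))`: `K (P v) = 0` (`map_proj_eq_zero`, ⇒ `hPr` for
   `T = ker K`), `P v = v` on `ker K` (`proj_eq_self_of_ker`, = `hPT`), `P (P v) = P v`; NO gap and NO adjointness needed;
§2 CONJUGATION ALGEBRA: with two-sided weights `w, winv` on `E` and `w′, w′inv` on `F`,
   `w (P (winv h)) = h − Ks_w (Hinv_w (K_w h))` for the conjugated operators `K_w = w′ K winv`, `Ks_w = w Ks w′inv`,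
   `Hinv_w = w′ Hinv w′inv` (`conj_proj_apply`); the three-term TELESCOPING of the defect (`proj_defect_eq`); the RESOLVENT
   IDENTITY `Hinv_w y − Hinv y = Hinv_w ((H − H_w)(Hinv y))` for the two-sided inverse (`conj_inv_sub_eq`);
§3 **`proj_conj_defect_le`**: from the pointwise bounds `‖K v‖ ≤ C_K‖v‖`, `‖Ks y‖ ≤ C_S‖y‖`, `‖Hinv y‖ ≤ C_H‖y‖` (Gram gap,
   `C_H = 1/γ`), the conjugated bounds `‖K_w v‖ ≤ C_K′‖v‖`, `‖Ks_w y‖ ≤ C_S′‖y‖`, `‖Hinv_w y‖ ≤ C_H′‖y‖` (Combes–Thomas) and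
   the finite-range DEFECTS `‖K_w v − K v‖ ≤ μ_K‖v‖`, `‖Ks_w y − Ks y‖ ≤ μ_S‖y‖`:
   **`‖w (P (winv h)) − P h‖ ≤ (μ_S·C_H·C_K + C_S′·C_H′·(μ_K·C_S + C_K′·μ_S)·C_H·C_K + C_S′·C_H′·μ_K)·‖h‖`** — LINEAR in
   `(μ_K, μ_S)`, i.e. `θa = O(μ)`; the mirror defect `θb` is the same theorem with the roles of `(w, winv)`, `(w′, w′inv)`
   exchanged (`proj_conj_defect_le'`);
§4 non-vacuity on `ℝ` (all hypotheses jointly satisfiable; the bound is attained with equality `0 ≤ 0` at `μ = 0`).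

HONEST FRAMING.  Finite-T⁴ bookkeeping (rung (B)+1 of the cell's ladder); abstract linear algebra — NOTHING is asserted about
Bałaban's averaging operators, the Landau gauge block, their Gram gaps or their ranges (those are the instantiation rows
S6-Y8 (a)(b), road P3's call); no conditional of the cell (`BetaPertH`, (B), G-an2-4) is used or hidden; «NE3-E ∕ NE3-loc
CONDITIONAL on ⟨RelLandauRep, TangentCoercive⟩» is unchanged; **NE3 is NOT proved**; spine PROVED 0∕9; NOT infinite volume,
NOT a mass gap, NOT the Clay problem, NOT summit progress.  ABSOLUTE RULE kept: no printed sentence is a hypothesis; no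
`def … : Prop` fact; 0 `def`, 0 `sorry`; axioms ⊆ {propext, Classical.choice, Quot.sound}.  Context only: J.-M. Combes &
L. Thomas, Commun. Math. Phys. 34 (1973) 251–270; S. Demko, W. Moss, P. Smith, Math. Comp. 43 (1984) 491–499.  PLACEMENT
(human rule 2026-08-19): our lemmas under `Summits/QuantumFields/BalabanUV/`; imports Mathlib only.
HONEST DEPENDENCY: continuum YM on T⁴ ⇐ BetaPertH ∧ nine spine estimates (0/9 proved); BetaPertH ⇐ (D1) ∧ (D4) ∧ CAP+tail;
G-an2-4 gates asym, D1 and NE2/3/4.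
-/

set_option autoImplicit false

namespace Summit.QuantumFields.BalabanUV.T4Continuum.NE3ProjectorDefect

/-! ## §1 The constraint projector: range in `ker K`, identity on `ker K`, idempotent -/

section Algebra

variable {E F : Type*} [AddCommGroup E] [Module ℝ E] [AddCommGroup F] [Module ℝ F]

/-- **`K ∘ P = 0`**: if `Hinv` is a right inverse of the Gram operator `K ∘ Ks` and `P = 1 − Ks·Hinv·K` pointwise, then `P`
maps into `ker K` (the consumer's `hPr` with `T = ker K`). [folklore] -/
theorem map_proj_eq_zero (K : E →ₗ[ℝ] F) (Ks : F →ₗ[ℝ] E) (Hinv : F →ₗ[ℝ] F) (P : E →ₗ[ℝ] E)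
    (hright : ∀ y, K (Ks (Hinv y)) = y) (hP : ∀ v, P v = v - Ks (Hinv (K v))) (v : E) : K (P v) = 0 := by
  rw [hP, map_sub, hright, sub_self]

/-- The same, as membership in the kernel submodule. [folklore] -/
theorem proj_mem_ker (K : E →ₗ[ℝ] F) (Ks : F →ₗ[ℝ] E) (Hinv : F →ₗ[ℝ] F) (P : E →ₗ[ℝ] E)
    (hright : ∀ y, K (Ks (Hinv y)) = y) (hP : ∀ v, P v = v - Ks (Hinv (K v))) (v : E) :
    P v ∈ LinearMap.ker K :=
  LinearMap.mem_ker.mpr (map_proj_eq_zero K Ks Hinv P hright hP v)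

/-- **`P = 1` ON `ker K`** (the consumer's `hPT`): no gap, no adjointness needed. [folklore] -/
theorem proj_eq_self_of_ker (K : E →ₗ[ℝ] F) (Ks : F →ₗ[ℝ] E) (Hinv : F →ₗ[ℝ] F) (P : E →ₗ[ℝ] E)
    (hP : ∀ v, P v = v - Ks (Hinv (K v))) {v : E} (hv : K v = 0) : P v = v := by
  rw [hP, hv, map_zero, map_zero, sub_zero]

/-- The same from submodule membership. [folklore] -/
theorem proj_eq_self_of_mem_ker (K : E →ₗ[ℝ] F) (Ks : F →ₗ[ℝ] E) (Hinv : F →ₗ[ℝ] F) (P : E →ₗ[ℝ] E)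
    (hP : ∀ v, P v = v - Ks (Hinv (K v))) {v : E} (hv : v ∈ LinearMap.ker K) : P v = v :=
  proj_eq_self_of_ker K Ks Hinv P hP (LinearMap.mem_ker.mp hv)

/-- `P` is idempotent. [folklore] -/
theorem proj_idem (K : E →ₗ[ℝ] F) (Ks : F →ₗ[ℝ] E) (Hinv : F →ₗ[ℝ] F) (P : E →ₗ[ℝ] E)
    (hright : ∀ y, K (Ks (Hinv y)) = y) (hP : ∀ v, P v = v - Ks (Hinv (K v))) (v : E) : P (P v) = P v :=
  proj_eq_self_of_ker K Ks Hinv P hP (map_proj_eq_zero K Ks Hinv P hright hP v)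

/-- `1 − P` kills nothing but the constraint directions: `v − P v = Ks (Hinv (K v))`. [folklore] -/
theorem sub_proj_eq (K : E →ₗ[ℝ] F) (Ks : F →ₗ[ℝ] E) (Hinv : F →ₗ[ℝ] F) (P : E →ₗ[ℝ] E)
    (hP : ∀ v, P v = v - Ks (Hinv (K v))) (v : E) : v - P v = Ks (Hinv (K v)) := by
  rw [hP]; abel

/-! ## §2 Conjugation by the weight: the conjugated projector, the telescoping, the resolvent identity -/

/-- **THE CONJUGATED PROJECTOR**: with two-sided weights `w ∘ winv = 1` on `E` and `w′inv ∘ w′ = 1` on `F`,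
`w (P (winv h)) = h − Ks_w (Hinv_w (K_w h))`, `K_w = w′ K winv`, `Ks_w = w Ks w′inv`, `Hinv_w = w′ Hinv w′inv`. [folklore] -/
theorem conj_proj_apply (K : E →ₗ[ℝ] F) (Ks : F →ₗ[ℝ] E) (Hinv : F →ₗ[ℝ] F) (P : E →ₗ[ℝ] E)
    (w winv : E →ₗ[ℝ] E) (w' w'inv : F →ₗ[ℝ] F)
    (hw : ∀ v, w (winv v) = v) (hw' : ∀ y, w'inv (w' y) = y)
    (hP : ∀ v, P v = v - Ks (Hinv (K v))) (h : E) :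
    w (P (winv h)) = h - w (Ks (w'inv (w' (Hinv (w'inv (w' (K (winv h)))))))) := by
  rw [hP, map_sub, hw, hw', hw']

/-- **THE THREE-TERM TELESCOPING OF THE DEFECT**:
`w P winv h − P h = −[(Ks_w − Ks)(Hinv (K h)) + Ks_w ((Hinv_w − Hinv)(K h)) + Ks_w (Hinv_w ((K_w − K) h))]`, written with the
conjugated operators expanded. [folklore] -/
theorem proj_defect_eq (K : E →ₗ[ℝ] F) (Ks : F →ₗ[ℝ] E) (Hinv : F →ₗ[ℝ] F) (P : E →ₗ[ℝ] E)
    (w winv : E →ₗ[ℝ] E) (w' w'inv : F →ₗ[ℝ] F)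
    (hw : ∀ v, w (winv v) = v) (hw' : ∀ y, w'inv (w' y) = y)
    (hP : ∀ v, P v = v - Ks (Hinv (K v))) (h : E) :
    w (P (winv h)) - P h
      = -((w (Ks (w'inv (Hinv (K h)))) - Ks (Hinv (K h)))
          + w (Ks (w'inv (w' (Hinv (w'inv (K h))) - Hinv (K h))))
          + w (Ks (w'inv (w' (Hinv (w'inv (w' (K (winv h)) - K h))))))) := by
  rw [conj_proj_apply K Ks Hinv P w winv w' w'inv hw hw' hP, hP]
  simp only [map_sub]
  abel

/-- **THE RESOLVENT IDENTITY FOR THE CONJUGATED INVERSE**: if `Hinv` is a two-sided inverse of the Gram operator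
`H = K ∘ Ks` and `w′, w′inv` are mutually inverse weights on `F`, then `Hinv_w y − Hinv y = Hinv_w ((H − H_w)(Hinv y))`
with `Hinv_w = w′ Hinv w′inv` and `H_w = w′ H w′inv` (here written out: `H_w z = w′ (K (Ks (w′inv z)))`). [folklore] -/
theorem conj_inv_sub_eq (K : E →ₗ[ℝ] F) (Ks : F →ₗ[ℝ] E) (Hinv : F →ₗ[ℝ] F) (w' w'inv : F →ₗ[ℝ] F)
    (hw'1 : ∀ y, w'inv (w' y) = y) (hw'2 : ∀ y, w' (w'inv y) = y)
    (hright : ∀ y, K (Ks (Hinv y)) = y) (hleft : ∀ y, Hinv (K (Ks y)) = y) (y : F) :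
    w' (Hinv (w'inv y)) - Hinv y
      = w' (Hinv (w'inv (K (Ks (Hinv y)) - w' (K (Ks (w'inv (Hinv y))))))) := by
  rw [map_sub, map_sub, map_sub, hright, hw'1, hleft, hw'2]

end Algebra

/-! ## §3 The weight-conjugation defect of the projector is `O(μ)` -/

section Bounds

variable {E F : Type*} [NormedAddCommGroup E] [NormedSpace ℝ E] [NormedAddCommGroup F] [NormedSpace ℝ F]

/-- The conjugated Gram operator differs from the Gram operator by the finite-range defects:
`‖K (Ks z) − K_w (Ks_w z)‖ ≤ (μ_K·C_S + C_K′·μ_S)·‖z‖`. [folklore] -/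
theorem gram_defect_le (K : E →ₗ[ℝ] F) (Ks : F →ₗ[ℝ] E) (w : E →ₗ[ℝ] E) (winv : E →ₗ[ℝ] E) (w' w'inv : F →ₗ[ℝ] F)
    (hw2 : ∀ v, winv (w v) = v)
    {CS CK' μK μS : ℝ} (hCK' : 0 ≤ CK') (hμK : 0 ≤ μK)
    (hKs : ∀ y, ‖Ks y‖ ≤ CS * ‖y‖) (hKw : ∀ v, ‖w' (K (winv v))‖ ≤ CK' * ‖v‖)
    (hdK : ∀ v, ‖w' (K (winv v)) - K v‖ ≤ μK * ‖v‖) (hdKs : ∀ y, ‖w (Ks (w'inv y)) - Ks y‖ ≤ μS * ‖y‖) (z : F) :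
    ‖K (Ks z) - w' (K (Ks (w'inv z)))‖ ≤ (μK * CS + CK' * μS) * ‖z‖ := by
  -- `K Ks z − K_w Ks_w z = −[(K_w − K)(Ks z) + K_w((Ks_w − Ks) z)]`, with `K_w (Ks_w z) = w′ K winv w Ks w′inv z = w′ K Ks w′inv z`
  have e1 : K (Ks z) - w' (K (Ks (w'inv z)))
      = -((w' (K (winv (Ks z))) - K (Ks z)) + (w' (K (winv (w (Ks (w'inv z)) - Ks z))))) := by
    rw [map_sub, hw2]
    simp only [map_sub]
    abel
  rw [e1, norm_neg]
  calc ‖(w' (K (winv (Ks z))) - K (Ks z)) + w' (K (winv (w (Ks (w'inv z)) - Ks z)))‖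
      ≤ ‖w' (K (winv (Ks z))) - K (Ks z)‖ + ‖w' (K (winv (w (Ks (w'inv z)) - Ks z)))‖ := norm_add_le _ _
    _ ≤ μK * ‖Ks z‖ + CK' * ‖w (Ks (w'inv z)) - Ks z‖ := add_le_add (hdK _) (hKw _)
    _ ≤ μK * (CS * ‖z‖) + CK' * (μS * ‖z‖) :=
        add_le_add (mul_le_mul_of_nonneg_left (hKs z) hμK) (mul_le_mul_of_nonneg_left (hdKs z) hCK')
    _ = (μK * CS + CK' * μS) * ‖z‖ := by ring

/-- The conjugated inverse differs from the inverse by the resolvent identity: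
`‖Hinv_w y − Hinv y‖ ≤ C_H′·(μ_K·C_S + C_K′·μ_S)·C_H·‖y‖`. [folklore] -/
theorem conj_inv_defect_le (K : E →ₗ[ℝ] F) (Ks : F →ₗ[ℝ] E) (Hinv : F →ₗ[ℝ] F)
    (w winv : E →ₗ[ℝ] E) (w' w'inv : F →ₗ[ℝ] F)
    (hw2 : ∀ v, winv (w v) = v) (hw'1 : ∀ y, w'inv (w' y) = y) (hw'2 : ∀ y, w' (w'inv y) = y)
    (hright : ∀ y, K (Ks (Hinv y)) = y) (hleft : ∀ y, Hinv (K (Ks y)) = y)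
    {CS CK' CH CHw μK μS : ℝ} (hCK' : 0 ≤ CK') (hCHw : 0 ≤ CHw) (hμK : 0 ≤ μK) (hμ : 0 ≤ μK * CS + CK' * μS)
    (hKs : ∀ y, ‖Ks y‖ ≤ CS * ‖y‖) (hKw : ∀ v, ‖w' (K (winv v))‖ ≤ CK' * ‖v‖)
    (hHinv : ∀ y, ‖Hinv y‖ ≤ CH * ‖y‖) (hHinvw : ∀ y, ‖w' (Hinv (w'inv y))‖ ≤ CHw * ‖y‖)
    (hdK : ∀ v, ‖w' (K (winv v)) - K v‖ ≤ μK * ‖v‖) (hdKs : ∀ y, ‖w (Ks (w'inv y)) - Ks y‖ ≤ μS * ‖y‖) (y : F) :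
    ‖w' (Hinv (w'inv y)) - Hinv y‖ ≤ CHw * ((μK * CS + CK' * μS) * CH) * ‖y‖ := by
  rw [conj_inv_sub_eq K Ks Hinv w' w'inv hw'1 hw'2 hright hleft y]
  have hz := gram_defect_le K Ks w winv w' w'inv hw2 hCK' hμK hKs hKw hdK hdKs (Hinv y)
  calc ‖w' (Hinv (w'inv (K (Ks (Hinv y)) - w' (K (Ks (w'inv (Hinv y)))))))‖
      ≤ CHw * ‖K (Ks (Hinv y)) - w' (K (Ks (w'inv (Hinv y))))‖ := hHinvw _
    _ ≤ CHw * ((μK * CS + CK' * μS) * ‖Hinv y‖) := mul_le_mul_of_nonneg_left hz hCHw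
    _ ≤ CHw * ((μK * CS + CK' * μS) * (CH * ‖y‖)) :=
        mul_le_mul_of_nonneg_left (mul_le_mul_of_nonneg_left (hHinv y) hμ) hCHw
    _ = CHw * ((μK * CS + CK' * μS) * CH) * ‖y‖ := by ring

/-- **THE WEIGHT-CONJUGATION DEFECT OF THE CONSTRAINT PROJECTOR** (the consumer's `hda` with `N = ‖·‖`): for
`P = 1 − Ks·Hinv·K` with `Hinv` a two-sided inverse of `K ∘ Ks`, two-sided weights, and the pointwise bounds
`‖K v‖ ≤ C_K‖v‖`, `‖Ks y‖ ≤ C_S‖y‖`, `‖Hinv y‖ ≤ C_H‖y‖` (Gram gap), conjugated `‖K_w v‖ ≤ C_K′‖v‖`, `‖Ks_w y‖ ≤ C_S′‖y‖`,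
`‖Hinv_w y‖ ≤ C_H′‖y‖` (Combes–Thomas), finite-range defects `‖K_w v − K v‖ ≤ μ_K‖v‖`, `‖Ks_w y − Ks y‖ ≤ μ_S‖y‖`:
`‖w (P (winv h)) − P h‖ ≤ (μ_S·C_H·C_K + C_S′·C_H′·(μ_K·C_S + C_K′·μ_S)·C_H·C_K + C_S′·C_H′·μ_K)·‖h‖` — linear in the
defects, `θa = O(μ)`. [folklore] -/
theorem proj_conj_defect_le (K : E →ₗ[ℝ] F) (Ks : F →ₗ[ℝ] E) (Hinv : F →ₗ[ℝ] F) (P : E →ₗ[ℝ] E)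
    (w winv : E →ₗ[ℝ] E) (w' w'inv : F →ₗ[ℝ] F)
    (hw1 : ∀ v, w (winv v) = v) (hw2 : ∀ v, winv (w v) = v) (hw'1 : ∀ y, w'inv (w' y) = y) (hw'2 : ∀ y, w' (w'inv y) = y)
    (hright : ∀ y, K (Ks (Hinv y)) = y) (hleft : ∀ y, Hinv (K (Ks y)) = y)
    (hP : ∀ v, P v = v - Ks (Hinv (K v)))
    {CK CS CK' CS' CH CHw μK μS : ℝ} (hCK' : 0 ≤ CK') (hCS' : 0 ≤ CS') (hCH : 0 ≤ CH) (hCHw : 0 ≤ CHw)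
    (hμK : 0 ≤ μK) (hμS : 0 ≤ μS) (hCS : 0 ≤ CS)
    (hK : ∀ v, ‖K v‖ ≤ CK * ‖v‖) (hKs : ∀ y, ‖Ks y‖ ≤ CS * ‖y‖) (hHinv : ∀ y, ‖Hinv y‖ ≤ CH * ‖y‖)
    (hKw : ∀ v, ‖w' (K (winv v))‖ ≤ CK' * ‖v‖) (hKsw : ∀ y, ‖w (Ks (w'inv y))‖ ≤ CS' * ‖y‖)
    (hHinvw : ∀ y, ‖w' (Hinv (w'inv y))‖ ≤ CHw * ‖y‖)
    (hdK : ∀ v, ‖w' (K (winv v)) - K v‖ ≤ μK * ‖v‖) (hdKs : ∀ y, ‖w (Ks (w'inv y)) - Ks y‖ ≤ μS * ‖y‖) (h : E) :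
    ‖w (P (winv h)) - P h‖
      ≤ (μS * CH * CK + CS' * (CHw * ((μK * CS + CK' * μS) * CH)) * CK + CS' * CHw * μK) * ‖h‖ := by
  have hμ : 0 ≤ μK * CS + CK' * μS := by positivity
  rw [proj_defect_eq K Ks Hinv P w winv w' w'inv hw1 hw'1 hP h, norm_neg]
  -- the three terms
  have hKh : ‖K h‖ ≤ CK * ‖h‖ := hK h
  have t1 : ‖w (Ks (w'inv (Hinv (K h)))) - Ks (Hinv (K h))‖ ≤ μS * CH * CK * ‖h‖ := by
    calc ‖w (Ks (w'inv (Hinv (K h)))) - Ks (Hinv (K h))‖ ≤ μS * ‖Hinv (K h)‖ := hdKs _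
      _ ≤ μS * (CH * ‖K h‖) := mul_le_mul_of_nonneg_left (hHinv _) hμS
      _ ≤ μS * (CH * (CK * ‖h‖)) := mul_le_mul_of_nonneg_left (mul_le_mul_of_nonneg_left hKh hCH) hμS
      _ = μS * CH * CK * ‖h‖ := by ring
  have t2 : ‖w (Ks (w'inv (w' (Hinv (w'inv (K h))) - Hinv (K h))))‖
      ≤ CS' * (CHw * ((μK * CS + CK' * μS) * CH)) * CK * ‖h‖ := by
    have hres := conj_inv_defect_le K Ks Hinv w winv w' w'inv hw2 hw'1 hw'2 hright hleft hCK' hCHw hμK hμ hKs hKw hHinv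
      hHinvw hdK hdKs (K h)
    calc ‖w (Ks (w'inv (w' (Hinv (w'inv (K h))) - Hinv (K h))))‖
        ≤ CS' * ‖w' (Hinv (w'inv (K h))) - Hinv (K h)‖ := hKsw _
      _ ≤ CS' * (CHw * ((μK * CS + CK' * μS) * CH) * ‖K h‖) := mul_le_mul_of_nonneg_left hres hCS'
      _ ≤ CS' * (CHw * ((μK * CS + CK' * μS) * CH) * (CK * ‖h‖)) :=
          mul_le_mul_of_nonneg_left (mul_le_mul_of_nonneg_left hKh (by positivity)) hCS'
      _ = CS' * (CHw * ((μK * CS + CK' * μS) * CH)) * CK * ‖h‖ := by ring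
  have t3 : ‖w (Ks (w'inv (w' (Hinv (w'inv (w' (K (winv h)) - K h))))))‖ ≤ CS' * CHw * μK * ‖h‖ := by
    calc ‖w (Ks (w'inv (w' (Hinv (w'inv (w' (K (winv h)) - K h))))))‖
        ≤ CS' * ‖w' (Hinv (w'inv (w' (K (winv h)) - K h)))‖ := hKsw _
      _ ≤ CS' * (CHw * ‖w' (K (winv h)) - K h‖) := mul_le_mul_of_nonneg_left (hHinvw _) hCS'
      _ ≤ CS' * (CHw * (μK * ‖h‖)) := mul_le_mul_of_nonneg_left (mul_le_mul_of_nonneg_left (hdK h) hCHw) hCS'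
      _ = CS' * CHw * μK * ‖h‖ := by ring
  calc ‖(w (Ks (w'inv (Hinv (K h)))) - Ks (Hinv (K h)))
          + w (Ks (w'inv (w' (Hinv (w'inv (K h))) - Hinv (K h))))
          + w (Ks (w'inv (w' (Hinv (w'inv (w' (K (winv h)) - K h))))))‖
      ≤ ‖w (Ks (w'inv (Hinv (K h)))) - Ks (Hinv (K h))‖
          + ‖w (Ks (w'inv (w' (Hinv (w'inv (K h))) - Hinv (K h))))‖
          + ‖w (Ks (w'inv (w' (Hinv (w'inv (w' (K (winv h)) - K h))))))‖ := norm_add₃_le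
    _ ≤ μS * CH * CK * ‖h‖ + CS' * (CHw * ((μK * CS + CK' * μS) * CH)) * CK * ‖h‖ + CS' * CHw * μK * ‖h‖ :=
        add_le_add (add_le_add t1 t2) t3
    _ = _ := by ring

/-- **THE MIRROR DEFECT** (the consumer's `hdb`): the same theorem with the roles of `(w, winv)` and `(w′, w′inv)`
exchanged bounds `‖P h − winv (P (w h))‖`. [folklore] -/
theorem proj_conj_defect_le' (K : E →ₗ[ℝ] F) (Ks : F →ₗ[ℝ] E) (Hinv : F →ₗ[ℝ] F) (P : E →ₗ[ℝ] E)
    (w winv : E →ₗ[ℝ] E) (w' w'inv : F →ₗ[ℝ] F)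
    (hw1 : ∀ v, w (winv v) = v) (hw2 : ∀ v, winv (w v) = v) (hw'1 : ∀ y, w'inv (w' y) = y) (hw'2 : ∀ y, w' (w'inv y) = y)
    (hright : ∀ y, K (Ks (Hinv y)) = y) (hleft : ∀ y, Hinv (K (Ks y)) = y)
    (hP : ∀ v, P v = v - Ks (Hinv (K v)))
    {CK CS CK' CS' CH CHw μK μS : ℝ} (hCK' : 0 ≤ CK') (hCS' : 0 ≤ CS') (hCH : 0 ≤ CH) (hCHw : 0 ≤ CHw)
    (hμK : 0 ≤ μK) (hμS : 0 ≤ μS) (hCS : 0 ≤ CS)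
    (hK : ∀ v, ‖K v‖ ≤ CK * ‖v‖) (hKs : ∀ y, ‖Ks y‖ ≤ CS * ‖y‖) (hHinv : ∀ y, ‖Hinv y‖ ≤ CH * ‖y‖)
    (hKw : ∀ v, ‖w'inv (K (w v))‖ ≤ CK' * ‖v‖) (hKsw : ∀ y, ‖winv (Ks (w' y))‖ ≤ CS' * ‖y‖)
    (hHinvw : ∀ y, ‖w'inv (Hinv (w' y))‖ ≤ CHw * ‖y‖)
    (hdK : ∀ v, ‖w'inv (K (w v)) - K v‖ ≤ μK * ‖v‖) (hdKs : ∀ y, ‖winv (Ks (w' y)) - Ks y‖ ≤ μS * ‖y‖) (h : E) :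
    ‖P h - winv (P (w h))‖
      ≤ (μS * CH * CK + CS' * (CHw * ((μK * CS + CK' * μS) * CH)) * CK + CS' * CHw * μK) * ‖h‖ := by
  rw [norm_sub_rev]
  exact proj_conj_defect_le K Ks Hinv P winv w w'inv w' hw2 hw1 hw'2 hw'1 hright hleft hP hCK' hCS' hCH hCHw hμK hμS
    hCS hK hKs hHinv hKw hKsw hHinvw hdK hdKs h

end Bounds

/-! ## §4 Non-vacuity -/

/-- All hypotheses of `proj_conj_defect_le` hold at once on `E = F = ℝ` with `K = Ks = Hinv = w = winv = w′ = w′inv = id`,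
every constant `1` and both defects `0`: the projector is then `0` (`P v = v − v`) and the bound reads `0 ≤ 0`. -/
example (h : ℝ) : ‖(LinearMap.id : ℝ →ₗ[ℝ] ℝ) ((0 : ℝ →ₗ[ℝ] ℝ) ((LinearMap.id : ℝ →ₗ[ℝ] ℝ) h)) - (0 : ℝ →ₗ[ℝ] ℝ) h‖
    ≤ (0 * 1 * 1 + 1 * (1 * ((0 * 1 + 1 * 0) * 1)) * 1 + 1 * 1 * 0) * ‖h‖ :=
  proj_conj_defect_le (E := ℝ) (F := ℝ) LinearMap.id LinearMap.id LinearMap.id 0 LinearMap.id LinearMap.id LinearMap.id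
    LinearMap.id (fun _ => rfl) (fun _ => rfl) (fun _ => rfl) (fun _ => rfl) (fun _ => rfl) (fun _ => rfl)
    (fun v => by simp) (CK := 1) (CS := 1) (CK' := 1) (CS' := 1) (CH := 1) (CHw := 1) (μK := 0) (μS := 0)
    zero_le_one zero_le_one zero_le_one zero_le_one le_rfl le_rfl zero_le_one
    (fun v => by simp) (fun y => by simp) (fun y => by simp) (fun v => by simp) (fun y => by simp) (fun y => by simp)
    (fun v => by simp) (fun y => by simp) h

end Summit.QuantumFields.BalabanUV.T4Continuum.NE3ProjectorDefect
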